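import Summits.CriticalPhenomena.PercolationContinuityZ3.Theses.PercShatteringRace
import Summits.CriticalPhenomena.PercolationContinuityZ3.Theorems.FreeBoxPowerSaving.Negative.FreeBoxPowerSavingProfile
import Summits.CriticalPhenomena.PercolationContinuityZ3.Theorems.FreeBoxSparse.Negative.DCTFloor
import Literature.Probability.Percolation.RSW

/-!
# Negative / tightness lemmas for the crux `FreeSusceptibilityPowerSaving` = S(1/2)
# (stmt-CriticalPhenomena-5786, route `PercShatteringRace`)

Standing crux disprover (refuter-cdisprove-stmt-CriticalPhenomena-5786). The crux is the
centre-rooted free-susceptibility power saving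
`∃ C, ∀ R ≥ 1, F(p_c, R) ≤ C R^{5/2}`, where `F(p, R) := Σ_{y ∈ B(R)} P_p(0 ↔ y in B(R))`
(bond percolation on `ℤ³`, free box `B(R) = box 3 R`). All statements below are written over the
inline quantity `F`; nothing new is defined. Proved here (everything sorry-free):

* LOAD-BEARING: `false_without_one_le` (the guard `1 ≤ R`: `F(p,0) = 1 > C·0^{5/2}`);
  `not_bound_one` (the bound with exponent `e < 3` is false at `p = 1`, where `F(1,R) = (2R+1)³`,
  tree: `real_openConnIn_one`); `bounded_of_lt_criticalProb` (for `p < p_c` even exponent `0` holds: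
  `F(p,R) ≤ χ(p)`, tree: `summable_tau_of_lt_criticalProb`); `sum_mono_p` / `iff_uniform` (S at `p_c`
  ⟺ S uniformly on `[0, p_c]`) — the crux lives exactly at `p_c`.
* EXPONENT WINDOW: `not_bound_of_lt_one` — no bound `F(p,R) ≤ C R^e` with `e < 1` at any `p ≥ p_c`
  (Duminil-Copin–Tassion floor `F(p,R) ≥ (R+1)/6`, tree: `sum_box_real_openConnIn_ge`); together with
  the trivial `F ≤ (2R+1)³` the rigorous window is `e ∈ [1, 3]`; the crux asks `e = 5/2`
  (numerics `2 − η ≈ 2.05`).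
* STRUCTURE: `sum_mono_R` and `bound_of_dyadic` (it suffices to bound `F` along `R = 2^k`);
  `not_boxLRO_of_freeSusceptibilityPowerSaving` (S refutes linear-scale in-box long-range order at
  `p_c`, the monolithic jump branch — why S has no soft proof);
  `not_freeSusceptibilityPowerSaving_of_not_freeBoxPowerSaving` (S(1/2) ⟹ the sibling crux
  `FreeBoxPowerSaving` of route PercNonProliferation, tree: `freeBoxPowerSaving_iff_centredPowerSaving`).
-/

namespace Summit.CriticalPhenomena.PercolationContinuityZ3.Theorems.FreeSusceptibilityPowerSaving.Negative

open MeasureTheory Filter Topology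
open Literature.Probability.Percolation Literature.Probability.LatticeModels
open Literature.Probability.Percolation.DCT16
open Summit.CriticalPhenomena.PercolationContinuityZ3.Theses.PercShatteringRace (FreeSusceptibilityPowerSaving)
open Summit.CriticalPhenomena.PercolationContinuityZ3.Theses.PercNonProliferation (FreeBoxPowerSaving)
open Summit.CriticalPhenomena.PercolationContinuityZ3.Theorems.FreeBoxSparse.Negative (sum_box_real_openConnIn_ge)
open Summit.CriticalPhenomena.PercolationContinuityZ3.FreeBoxPowerSavingNegative
  (real_openConnIn_one real_openConnIn_le_tau freeBoxPowerSaving_iff_centredPowerSaving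
    openConnIn_self_eq_univ)

noncomputable section

/-! ### Elementary facts about `F(p, R) = Σ_{y ∈ B(R)} P_p(0 ↔ y in B(R))` -/

/-- The `y = 0` term: `P_p(0 ↔ 0 in B(R)) = 1`. [folklore] -/
theorem real_openConnIn_zero_zero (p : unitInterval) (R : ℕ) :
    (bondPercolation (zdGraph 3) p).real (openConnIn (↑(box 3 R) : Set (Site 3)) 0 0) = 1 := by
  rw [openConnIn_self_eq_univ (Finset.mem_coe.2 (zero_mem_box 3 R)), probReal_univ]

/-- `B(0) = {0}`. [folklore] -/
theorem box_three_zero : box 3 0 = {0} := by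
  ext x
  simp only [mem_box, Nat.cast_zero, neg_zero, Finset.mem_singleton]
  constructor
  · intro h; funext i; have := h i; simp only [Pi.zero_apply]; omega
  · rintro rfl i; simp

/-- `F(p, R)` is non-decreasing in `p` (increasing events, monotone coupling). [folklore] -/
theorem sum_mono_p {p q : unitInterval} (hpq : p ≤ q) (R : ℕ) :
    ∑ y ∈ box 3 R, (bondPercolation (zdGraph 3) p).real (openConnIn (↑(box 3 R) : Set (Site 3)) 0 y) ≤
      ∑ y ∈ box 3 R, (bondPercolation (zdGraph 3) q).real (openConnIn (↑(box 3 R) : Set (Site 3)) 0 y) :=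
  Finset.sum_le_sum fun y _ => real_mono_of_isUpperSet (zdGraph 3) (isUpperSet_openConnIn _ _ _)
    (measurableSet_openConnIn _ 0 y) hpq

/-- `F(p, R)` is non-decreasing in `R` (bigger box: more terms and larger events). [folklore] -/
theorem sum_mono_R (p : unitInterval) {R R' : ℕ} (hRR' : R ≤ R') :
    ∑ y ∈ box 3 R, (bondPercolation (zdGraph 3) p).real (openConnIn (↑(box 3 R) : Set (Site 3)) 0 y) ≤
      ∑ y ∈ box 3 R', (bondPercolation (zdGraph 3) p).real (openConnIn (↑(box 3 R') : Set (Site 3)) 0 y) :=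
  calc ∑ y ∈ box 3 R, (bondPercolation (zdGraph 3) p).real (openConnIn (↑(box 3 R) : Set (Site 3)) 0 y)
      ≤ ∑ y ∈ box 3 R, (bondPercolation (zdGraph 3) p).real
          (openConnIn (↑(box 3 R') : Set (Site 3)) 0 y) :=
        Finset.sum_le_sum fun y _ => measureReal_mono
          (openConnIn_mono (Finset.coe_subset.2 (box_mono 3 hRR')) 0 y)
    _ ≤ _ := Finset.sum_le_sum_of_subset_of_nonneg (box_mono 3 hRR') fun _ _ _ => measureReal_nonneg

/-! ### A growth lemma -/

/-- If eventually `f R ≥ a R^s` with `a > 0`, then no bound `f R ≤ C R^e` (`R ≥ 1`) with `e < s`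
holds. [folklore] -/
theorem not_bound_of_lower {f : ℕ → ℝ} {a s : ℝ} (ha : 0 < a) {N : ℕ}
    (hlow : ∀ R : ℕ, N ≤ R → a * (R : ℝ) ^ s ≤ f R) {e : ℝ} (he : e < s) :
    ¬ ∃ C : ℝ, ∀ R : ℕ, 1 ≤ R → f R ≤ C * (R : ℝ) ^ e := by
  rintro ⟨C, hC⟩
  have ht : Tendsto (fun R : ℕ => a * ((R : ℝ) ^ (s - e))) atTop atTop :=
    Tendsto.const_mul_atTop ha ((tendsto_rpow_atTop (sub_pos.2 he)).comp tendsto_natCast_atTop_atTop)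
  obtain ⟨R, hgt, hR1, hRN⟩ :=
    ((ht.eventually_gt_atTop C).and ((eventually_ge_atTop 1).and (eventually_ge_atTop N))).exists
  have hRpos : (0 : ℝ) < R := by exact_mod_cast hR1
  have h1 := (hlow R hRN).trans (hC R hR1)
  have hsplit : (R : ℝ) ^ s = (R : ℝ) ^ (s - e) * (R : ℝ) ^ e := by
    rw [← Real.rpow_add hRpos]; ring_nf
  rw [hsplit, ← mul_assoc] at h1
  have h2 := le_of_mul_le_mul_right h1 (Real.rpow_pos_of_pos hRpos e)
  linarith

/-! ### Load-bearing: the guard `1 ≤ R` -/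

/-- **The guard `1 ≤ R` cannot be dropped**: `∃ C, ∀ R, F(p, R) ≤ C R^{5/2}` is false at every `p`
(`R = 0`: left side `1`, right side `0`). [folklore] -/
theorem false_without_one_le (p : unitInterval) :
    ¬ ∃ C : ℝ, ∀ R : ℕ, ∑ y ∈ box 3 R,
      (bondPercolation (zdGraph 3) p).real (openConnIn (↑(box 3 R) : Set (Site 3)) 0 y)
        ≤ C * (R : ℝ) ^ ((5 : ℝ) / 2) := by
  rintro ⟨C, hC⟩
  have h := hC 0
  rw [box_three_zero, Finset.sum_singleton, ← box_three_zero, real_openConnIn_zero_zero, Nat.cast_zero,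
    Real.zero_rpow (by norm_num), mul_zero] at h
  exact absurd h (by norm_num)

/-! ### Load-bearing: the parameter — false at `p = 1`, bounded below `p_c` -/

/-- `F(1, R) = (2R+1)³`. [folklore] -/
theorem sum_one (R : ℕ) :
    ∑ y ∈ box 3 R, (bondPercolation (zdGraph 3) 1).real (openConnIn (↑(box 3 R) : Set (Site 3)) 0 y) =
      ((2 * R + 1) ^ 3 : ℕ) := by
  rw [Finset.sum_congr rfl fun y hy => real_openConnIn_one (zero_mem_box 3 R) hy, Finset.sum_const,
    card_box]
  simp

/-- **The crux's bound transplanted to `p = 1` is false for every exponent `e < 3`** (in particular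
`5/2`): a proof of S must use an input that fails at `p = 1`. [folklore] -/
theorem not_bound_one {e : ℝ} (he : e < 3) :
    ¬ ∃ C : ℝ, ∀ R : ℕ, 1 ≤ R → ∑ y ∈ box 3 R,
      (bondPercolation (zdGraph 3) 1).real (openConnIn (↑(box 3 R) : Set (Site 3)) 0 y)
        ≤ C * (R : ℝ) ^ e := by
  refine not_bound_of_lower (a := 1) (s := 3) one_pos (N := 0) (fun R _ => ?_) he
  rw [sum_one, one_mul, show (3 : ℝ) = (3 : ℕ) by norm_num, Real.rpow_natCast]
  exact_mod_cast Nat.pow_le_pow_left (by omega : R ≤ 2 * R + 1) 3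

/-- **Subcritical boundedness**: for `p < p_c`, `F(p, R) ≤ χ(p) = Σ_z τ_p(0, z) < ∞` for all `R`
(tree: `summable_tau_of_lt_criticalProb`), i.e. the exponent-`0` bound holds. [folklore] -/
theorem bounded_of_lt_criticalProb (p : unitInterval) (hp : (p : ℝ) < criticalProb (zdGraph 3) 0) :
    ∃ C : ℝ, ∀ R : ℕ, ∑ y ∈ box 3 R,
      (bondPercolation (zdGraph 3) p).real (openConnIn (↑(box 3 R) : Set (Site 3)) 0 y) ≤ C := by
  have hs := summable_tau_of_lt_criticalProb (d := 3) (by norm_num) p hp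
  refine ⟨∑' z : Site 3, tau 3 p 0 z, fun R => ?_⟩
  calc _ ≤ ∑ y ∈ box 3 R, tau 3 p 0 y := Finset.sum_le_sum fun y _ => real_openConnIn_le_tau p _ 0 y
    _ ≤ ∑' z : Site 3, tau 3 p 0 z := hs.sum_le_tsum _ fun z _ => tau_nonneg p 0 z

/-- **S at `p_c` ⟺ S uniformly on `[0, p_c]`** (same constant), by monotonicity in `p`. [folklore] -/
theorem iff_uniform :
    FreeSusceptibilityPowerSaving ↔ ∃ C : ℝ, ∀ p : unitInterval, p ≤ criticalProbI 3 →
      ∀ R : ℕ, 1 ≤ R → ∑ y ∈ box 3 R,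
        (bondPercolation (zdGraph 3) p).real (openConnIn (↑(box 3 R) : Set (Site 3)) 0 y)
          ≤ C * (R : ℝ) ^ ((5 : ℝ) / 2) :=
  ⟨fun ⟨C, hC⟩ => ⟨C, fun _ hp R hR => (sum_mono_p hp R).trans (hC R hR)⟩,
    fun ⟨C, hC⟩ => ⟨C, fun R hR => hC _ le_rfl R hR⟩⟩

/-! ### The exponent cannot go below `1` at any `p ≥ p_c` -/

/-- **Rigorous floor**: for `p ≥ p_c` no bound `F(p, R) ≤ C R^e` with `e < 1` holds, since
`F(p, R) ≥ (R+1)/6` (Duminil-Copin–Tassion `φ_p(S) ≥ 1`, tree: `sum_box_real_openConnIn_ge`).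
With `F ≤ (2R+1)³` the rigorous window for the crux's exponent is `[1, 3]`. [folklore] -/
theorem not_bound_of_lt_one (p : unitInterval) (hp : criticalProb (zdGraph 3) (0 : Site 3) ≤ p)
    {e : ℝ} (he : e < 1) :
    ¬ ∃ C : ℝ, ∀ R : ℕ, 1 ≤ R → ∑ y ∈ box 3 R,
      (bondPercolation (zdGraph 3) p).real (openConnIn (↑(box 3 R) : Set (Site 3)) 0 y)
        ≤ C * (R : ℝ) ^ e := by
  refine not_bound_of_lower (a := 1 / 6) (s := 1) (by norm_num) (N := 0) (fun R _ => ?_) he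
  rw [Real.rpow_one]
  have h := sum_box_real_openConnIn_ge p hp R
  linarith

/-- The crux-shaped bound at `p_c` forces `1 ≤ e`. [folklore] -/
theorem one_le_exponent {e C : ℝ}
    (h : ∀ R : ℕ, 1 ≤ R → ∑ y ∈ box 3 R,
      (bondPercolation (zdGraph 3) (criticalProbI 3)).real (openConnIn (↑(box 3 R) : Set (Site 3)) 0 y)
        ≤ C * (R : ℝ) ^ e) : 1 ≤ e := by
  by_contra he
  push Not at he
  exact not_bound_of_lt_one (criticalProbI 3) le_rfl he ⟨C, h⟩

/-! ### Dyadic reduction -/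

/-- **It suffices to bound `F` along `R = 2^k`** (`e ≥ 0`): monotonicity in `R`. [folklore] -/
theorem bound_of_dyadic (p : unitInterval) {e : ℝ} (he : 0 ≤ e) {C : ℝ}
    (h : ∀ k : ℕ, ∑ y ∈ box 3 (2 ^ k),
      (bondPercolation (zdGraph 3) p).real (openConnIn (↑(box 3 (2 ^ k)) : Set (Site 3)) 0 y)
        ≤ C * (2 : ℝ) ^ ((k : ℝ) * e)) :
    ∃ C' : ℝ, ∀ R : ℕ, 1 ≤ R → ∑ y ∈ box 3 R,
      (bondPercolation (zdGraph 3) p).real (openConnIn (↑(box 3 R) : Set (Site 3)) 0 y)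
        ≤ C' * (R : ℝ) ^ e := by
  refine ⟨max C 0 * (2 : ℝ) ^ e, fun R hR => ?_⟩
  set k := Nat.log 2 R + 1 with hk
  have hRlt : R < 2 ^ k := Nat.lt_pow_succ_log_self (by norm_num) R
  have hle : 2 ^ (k - 1) ≤ R := by
    rw [hk, Nat.add_sub_cancel]; exact Nat.pow_log_le_self 2 (by omega)
  have h2 : (2 : ℝ) ^ ((k : ℝ) - 1) = ((2 ^ (k - 1) : ℕ) : ℝ) := by
    rw [Nat.cast_pow, Nat.cast_ofNat, ← Real.rpow_natCast, Nat.cast_sub (by omega : 1 ≤ k),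
      Nat.cast_one]
  have hkR : (2 : ℝ) ^ ((k : ℝ) - 1) ≤ R := by rw [h2]; exact_mod_cast hle
  have hexp : (2 : ℝ) ^ ((k : ℝ) * e) = (2 : ℝ) ^ e * ((2 : ℝ) ^ ((k : ℝ) - 1)) ^ e := by
    rw [← Real.rpow_mul (by norm_num : (0 : ℝ) ≤ 2), ← Real.rpow_add (by norm_num : (0 : ℝ) < 2)]
    congr 1; ring
  calc _ ≤ ∑ y ∈ box 3 (2 ^ k), (bondPercolation (zdGraph 3) p).real
        (openConnIn (↑(box 3 (2 ^ k)) : Set (Site 3)) 0 y) := sum_mono_R p hRlt.le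
    _ ≤ C * (2 : ℝ) ^ ((k : ℝ) * e) := h k
    _ ≤ max C 0 * (2 : ℝ) ^ ((k : ℝ) * e) :=
        mul_le_mul_of_nonneg_right (le_max_left _ _) (by positivity)
    _ = max C 0 * (2 : ℝ) ^ e * ((2 : ℝ) ^ ((k : ℝ) - 1)) ^ e := by rw [hexp, mul_assoc]
    _ ≤ max C 0 * (2 : ℝ) ^ e * (R : ℝ) ^ e := by
        apply mul_le_mul_of_nonneg_left _ (by positivity)
        exact Real.rpow_le_rpow (by positivity) hkR he

/-! ### The monolithic-jump obstruction -/

/-- **In-box long-range order at linear scale kills every power saving**: if for large `R` every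
site of the half-box `B(⌊R/2⌋)` is joined to the centre inside `B(R)` with probability `≥ c > 0`,
then `F(p, R) ≥ c R³` and no bound `F(p, R) ≤ C R^e`, `e < 3`, holds. [folklore] -/
theorem not_bound_of_boxLRO (p : unitInterval) {c : ℝ} (hc : 0 < c) {N : ℕ}
    (h : ∀ R : ℕ, N ≤ R → ∀ y ∈ box 3 (R / 2),
      c ≤ (bondPercolation (zdGraph 3) p).real (openConnIn (↑(box 3 R) : Set (Site 3)) 0 y))
    {e : ℝ} (he : e < 3) :
    ¬ ∃ C : ℝ, ∀ R : ℕ, 1 ≤ R → ∑ y ∈ box 3 R,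
      (bondPercolation (zdGraph 3) p).real (openConnIn (↑(box 3 R) : Set (Site 3)) 0 y)
        ≤ C * (R : ℝ) ^ e := by
  refine not_bound_of_lower hc (N := N) (fun R hR => ?_) he
  have hsub : box 3 (R / 2) ⊆ box 3 R := box_mono 3 (Nat.div_le_self R 2)
  have hcard : (R : ℝ) ^ (3 : ℝ) ≤ (box 3 (R / 2)).card := by
    rw [show (3 : ℝ) = (3 : ℕ) by norm_num, Real.rpow_natCast, card_box]
    exact_mod_cast Nat.pow_le_pow_left (by omega : R ≤ 2 * (R / 2) + 1) 3
  calc c * (R : ℝ) ^ (3 : ℝ) ≤ c * (box 3 (R / 2)).card := mul_le_mul_of_nonneg_left hcard hc.le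
    _ = ∑ _y ∈ box 3 (R / 2), c := by rw [Finset.sum_const, nsmul_eq_mul, mul_comm]
    _ ≤ ∑ y ∈ box 3 (R / 2), (bondPercolation (zdGraph 3) p).real
          (openConnIn (↑(box 3 R) : Set (Site 3)) 0 y) := Finset.sum_le_sum fun y hy => h R hR y hy
    _ ≤ _ := Finset.sum_le_sum_of_subset_of_nonneg hsub fun _ _ _ => measureReal_nonneg

/-- **S refutes the monolithic jump branch**: under `FreeSusceptibilityPowerSaving` there is no
linear-scale in-box long-range order at `p_c` (`∃ c > 0, ∃ N, ∀ R ≥ N, ∀ y ∈ B(⌊R/2⌋),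
P_{p_c}(0 ↔ y in B(R)) ≥ c` is false). That statement is an open sub-case of `θ(p_c) > 0` (its
negation is the unproved free-box 'folklore', Hutchcroft arXiv:2202.07634 p. 5), which is why S admits
no soft proof. [folklore] -/
theorem not_boxLRO_of_freeSusceptibilityPowerSaving (hS : FreeSusceptibilityPowerSaving) :
    ¬ ∃ c : ℝ, 0 < c ∧ ∃ N : ℕ, ∀ R : ℕ, N ≤ R → ∀ y ∈ box 3 (R / 2),
      c ≤ (bondPercolation (zdGraph 3) (criticalProbI 3)).real
        (openConnIn (↑(box 3 R) : Set (Site 3)) 0 y) := by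
  rintro ⟨c, hc, N, hN⟩
  exact not_bound_of_boxLRO (criticalProbI 3) hc hN (by norm_num) hS

/-! ### Relation to the sibling crux `FreeBoxPowerSaving` (stmt-CriticalPhenomena-4447) -/

/-- **S(1/2) implies the pair-averaged power saving of route PercNonProliferation** (member `b = 5/2`
of `freeBoxPowerSaving_iff_centredPowerSaving`), stated contrapositively: a refutation of
`FreeBoxPowerSaving` refutes this crux. [folklore] -/
theorem not_freeSusceptibilityPowerSaving_of_not_freeBoxPowerSaving (h : ¬ FreeBoxPowerSaving) :
    ¬ FreeSusceptibilityPowerSaving := fun ⟨C, hC⟩ =>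
  h (freeBoxPowerSaving_iff_centredPowerSaving.2 ⟨(5 : ℝ) / 2, C, by norm_num, hC⟩)

end

end Summit.CriticalPhenomena.PercolationContinuityZ3.Theorems.FreeSusceptibilityPowerSaving.Negative
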